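import Summits.QuantumFields.BalabanUV.Beta.GAN24.FlatResolventPieces

/-!
# G-an2-4 ∕ (CONV-C), the SECOND-ORDER sup entries — THE ABSTRACT FLAT RESOLVENT STEP: for ANY operator `Gs` on the NE3 carrier
# inverse to `stencilE + Ms` (`Ms` a block-local mass term) whose ZEROTH-order cube rows are `≤ C_G·n²·e^{−δ_G·nbd}`, the FIRST-order
# rows are `≤ B·n·e^{−δ·nbd}` and the SECOND-order rows `≤ B·(1 + log n)·e^{−δ·nbd}`, in ROW form (`∇G`, `∇∇G`) and in OPERATOR form
# (`G∇^*`, `G∇^*∇^*`) — the reduction «scalar second-order sup letters ⇐ scalar zeroth-order sup entry» behind the requester's `𝒢′`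

G-an2-4 formalisation swarm `b2b-balaban-gan24-formalise-*`, leaf prover 06 (gen 35), crux team (2) under the coordinator ruling
«YM REDIRECT» (e34b3e0c).  WHY THIS FILE — the road-P2 crux prover's consumer (`GAN24/StaircaseLaplacianDefect` p253982 → the
announced `SoftMinimiserOneStepSup`) costs `‖𝒢′∂′ᴴ∂′ᴴ‖_{∞→∞}` and `‖𝒢′∂′ᴴ‖_{∞→∞}` for the SCALAR averaged Green function
`𝒢′ = ScalarAveragedPropagator.Gps = (LapS + a′•PiS)⁻¹`; the flat second-order chains of the swarm (leaf-03 (A)–(D), this seat's twins,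
leaf-04's transport) treat NE3's VECTOR `gFlat = n²·Re Δ_1⁻¹`, whose zeroth-order input is pv15's (1.110) first entry.  For the scalar
operator no n-uniform sup→sup bound of ANY order is in the tree (only ℓ²∕Combes–Thomas conjugation bounds, `Support/CTScalarGreen`).
THIS FILE isolates exactly what the resolvent step needs, free of the choice of operator: on the NE3 carrier
`X = (ℤ/NL^k)^{d+1} × Fin (d+1)` at a level `j ≤ k` (`n = L^j`), let `Ms, Gs : Matrix X X ℝ` with `(stencilE + Ms)·Gs = 1 = Gs·(stencilE + Ms)`,
block-local mass rows `Σ_{z ∈ Δ_j(b)} |Ms(x,z)| ≤ C_M·n⁻²·e^{−δ_M·nbd_j(Δ(x),b)}` and the ZEROTH-ORDER INPUT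
`Σ_{z ∈ Δ_j(b)} |Gs(x,z)| ≤ C_G·n²·e^{−δ_G·nbd_j(Δ(x),b)}` ((K₀): for `Gs = gFlat` this is NE3's `gFlat_rowBound`; for the scalar `𝒢′` it is
[B9] (3.42) `m = 0` at `U = 1`, NOT in the tree).  Then, with `B, δ > 0` depending on `(d, C_M, δ_M, C_G, δ_G)` only:
 * (part (i) `GAN24/FlatResolventPieces`: the translation dictionary, the weight shifts and the weighted rows of the four FREE pieces
   (F1) `rowDiff ν F ≤ C·n` (NE3 part 13), (F1ᶜ) `F·colDiff ν`, (F2) `rowDiff μ (rowDiff ν F) ≤ C·(1 + log n)` — the located log, leaf-03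
   gen 48's (C)∕(D) `SliceFlatFreeHessian`∕`SliceFlatHessian.weightedRow_rowDiff_rowDiff_freeOp` BY NAME — and (F2ᶜ) `F·colDiff μ·colDiff ν`;)
 * §1 **`resolventStep_bounds`** — the four conclusions
   `Σ_{q∈Δ_j(y₁)} |rowDiff ν Gs p q| ≤ B·L^j·e^{−δ·nbd}`, `Σ |rowDiff μ (rowDiff ν Gs) p q| ≤ B·(1 + log L^j)·e^{−δ·nbd}`,
   `Σ |(Gs·colDiff ν) p q| ≤ B·L^j·e^{−δ·nbd}`, `Σ |(Gs·colDiff μ·colDiff ν) p q| ≤ B·(1 + log L^j)·e^{−δ·nbd}`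
   from the two resolvent identities `Gs = F + F·W·Gs` and `Gs = F + Gs·W·F` (`W = n⁻²·1 − Ms`; `freeOp_mul_stencil` ∕ `stencil_mul_freeOp`),
   submultiplicativity of weighted rows and WEIGHTED ⇒ CUBE-LOCALISED;
 * §2 the vector instance as a CHECK: `Gs := gFlat j`, `Ms := n⁻²·1 − Wfl j` recovers the shapes of NE3 part 13 ∕ leaf-03 (D) (`example`).

HONEST SCOPE.  A REDUCTION, not a discharge: for the scalar `𝒢′` the zeroth-order input (K₀) is OPEN (located: [B9] Thm 3.1 (3.42)
`m = 0` p. 397 at `U = 1` ∕ the scalar twin of [B5] (1.110) entry 1 — TEXT LOCATIONS, nothing printed is used); [folklore] finite-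
dimensional bookkeeping over tree modules BY NAME; no `def`, no `def … : Prop`, no `sorry`.  NOT (CONV-C), NEVER «G-an2-4 closed», NOT
NE2 ∕ NE3, NOT D1, NOT BetaPertH, NOT continuum, NOT Clay; not in print — our bookkeeping.  ABSOLUTE RULE of the cell kept.  HONEST
DEPENDENCY: continuum YM on T⁴ ⇐ BetaPertH ∧ nine spine estimates (0/9 proved); BetaPertH ⇐ (D1) ∧ (D4) ∧ CAP+tail; G-an2-4 gates asym,
D1 and NE2/3/4.
-/

noncomputable section

open Real Finset Matrix

namespace Summit.QuantumFields.BalabanUV.Beta.GAN24.FlatResolventStep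

open Literature.MathematicalPhysics.QuantumFieldTheory.Balaban1983to89
open Literature.MathematicalPhysics.QuantumFieldTheory.Balaban1983to89.TreeLengthTorus (TPt)
open Literature.MathematicalPhysics.QuantumFieldTheory.Balaban1983to89.T4SliceOperatorData (countConst countConst_pos)
open Literature.MathematicalPhysics.QuantumFieldTheory.Balaban1983to89.B12Decay510Torus (pabs pabs_nonneg pabs_add_le
  pabs_le_abs_of_cast_eq pl1_eq_sum)
open Summit.QuantumFields.BalabanUV.T4Continuum
open SliceTorusBlocks SliceTorusTower SliceCovariantTower SliceFlatPropagator SliceFlatOperators SliceFlatStencil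
open SliceFlatGaugeDecay SliceFlatFreeResolvent SliceFlatGradientPrep SliceFlatGradient

variable (d k N L : ℕ) [NeZero N] [NeZero L]

open Summit.QuantumFields.BalabanUV.Beta.GAN24.FlatResolventPieces

/-! ## §1  THE ABSTRACT RESOLVENT STEP -/
section Step

/-- Rows of `A + A·R` from rows of `A` and `R` (multiplicative weight): `≤ a·(1 + r)`. [folklore] -/
theorem weightedRow_add_mul_right_le {X : Type*} [Fintype X] (A R : Matrix X X ℝ) (E : X → X → ℝ) {a r : ℝ} (hr : 0 ≤ r)
    (hE0 : ∀ x z, 0 ≤ E x z) (hE : ∀ x w z, E x z ≤ E x w * E w z)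
    (hA : ∀ x, ∑ z, |A x z| * E x z ≤ a) (hR : ∀ x, ∑ z, |R x z| * E x z ≤ r) (x : X) :
    ∑ z, |(A + A * R) x z| * E x z ≤ a * (1 + r) := by
  have h2 := weightedRow_mul_le A R E hr hE0 hE hA hR x
  calc ∑ z, |(A + A * R) x z| * E x z ≤ ∑ z, (|A x z| * E x z + |(A * R) x z| * E x z) := by
        refine Finset.sum_le_sum fun z _ => ?_
        rw [Matrix.add_apply, ← add_mul]
        exact mul_le_mul_of_nonneg_right (abs_add_le _ _) (hE0 x z)
    _ ≤ a + a * r := by rw [Finset.sum_add_distrib]; exact add_le_add (hA x) h2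
    _ = a * (1 + r) := by ring

/-- Rows of `A + S·A` from rows of `S` and `A` (multiplicative weight): `≤ a·(1 + s)` (`a ≥ 0`). [folklore] -/
theorem weightedRow_add_mul_left_le {X : Type*} [Fintype X] (A S : Matrix X X ℝ) (E : X → X → ℝ) {a s : ℝ} (ha : 0 ≤ a)
    (hE0 : ∀ x z, 0 ≤ E x z) (hE : ∀ x w z, E x z ≤ E x w * E w z)
    (hA : ∀ x, ∑ z, |A x z| * E x z ≤ a) (hS : ∀ x, ∑ z, |S x z| * E x z ≤ s) (x : X) :
    ∑ z, |(A + S * A) x z| * E x z ≤ a * (1 + s) := by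
  have h2 := weightedRow_mul_le S A E ha hE0 hE hS hA x
  calc ∑ z, |(A + S * A) x z| * E x z ≤ ∑ z, (|A x z| * E x z + |(S * A) x z| * E x z) := by
        refine Finset.sum_le_sum fun z _ => ?_
        rw [Matrix.add_apply, ← add_mul]
        exact mul_le_mul_of_nonneg_right (abs_add_le _ _) (hE0 x z)
    _ ≤ a + s * a := by rw [Finset.sum_add_distrib]; exact add_le_add (hA x) h2
    _ = a * (1 + s) := by ring

/-- The two resolvent identities around the free operator for ANY two-sided inverse `Gs` of `stencilE + Ms`, with `W = n⁻²·1 − Ms`: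
`Gs = F + F·(W·Gs)` and `Gs = F + (Gs·W)·F`. [folklore] -/
theorem resolvent_identities (j : ℕ)
    (Ms Gs : Matrix (TPt (d + 1) (N * L ^ k) × Fin (d + 1)) (TPt (d + 1) (N * L ^ k) × Fin (d + 1)) ℝ)
    (hKG : (stencilE d k N L + Ms) * Gs = 1) (hGK : Gs * (stencilE d k N L + Ms) = 1) :
    Gs = freeOp d k N L j + freeOp d k N L j * (((((side k L j : ℝ) ^ 2)⁻¹) • (1 : Matrix (TPt (d + 1) (N * L ^ k) × Fin (d + 1)) (TPt (d + 1) (N * L ^ k) × Fin (d + 1)) ℝ) - Ms) * Gs) ∧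
      Gs = freeOp d k N L j + Gs * ((((side k L j : ℝ) ^ 2)⁻¹) • (1 : Matrix (TPt (d + 1) (N * L ^ k) × Fin (d + 1)) (TPt (d + 1) (N * L ^ k) × Fin (d + 1)) ℝ) - Ms) * freeOp d k N L j := by
  have hW : (((side k L j : ℝ) ^ 2)⁻¹) • (1 : Matrix (TPt (d + 1) (N * L ^ k) × Fin (d + 1)) (TPt (d + 1) (N * L ^ k) × Fin (d + 1)) ℝ) - Ms
      = (stencilE d k N L + (((side k L j : ℝ) ^ 2)⁻¹) • (1 : Matrix (TPt (d + 1) (N * L ^ k) × Fin (d + 1)) (TPt (d + 1) (N * L ^ k) × Fin (d + 1)) ℝ)) - (stencilE d k N L + Ms) := by abel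
  constructor
  · have h1 : freeOp d k N L j * ((stencilE d k N L + (((side k L j : ℝ) ^ 2)⁻¹) • (1 : Matrix (TPt (d + 1) (N * L ^ k) × Fin (d + 1)) (TPt (d + 1) (N * L ^ k) × Fin (d + 1)) ℝ)) * Gs) = Gs := by
      rw [← Matrix.mul_assoc, freeOp_mul_stencil, Matrix.one_mul]
    have h2 : freeOp d k N L j * ((stencilE d k N L + Ms) * Gs) = freeOp d k N L j := by
      rw [hKG, Matrix.mul_one]
    rw [hW, Matrix.sub_mul, Matrix.mul_sub, h1, h2]; abel
  · have h1 : Gs * (stencilE d k N L + (((side k L j : ℝ) ^ 2)⁻¹) • (1 : Matrix (TPt (d + 1) (N * L ^ k) × Fin (d + 1)) (TPt (d + 1) (N * L ^ k) × Fin (d + 1)) ℝ)) * freeOp d k N L j = Gs := by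
      rw [Matrix.mul_assoc, stencil_mul_freeOp, Matrix.mul_one]
    have h2 : Gs * (stencilE d k N L + Ms) * freeOp d k N L j = freeOp d k N L j := by
      rw [hGK, Matrix.one_mul]
    rw [hW, Matrix.mul_sub, Matrix.sub_mul, h1, h2]; abel

/-- **The step in WEIGHTED form.**  At a level `j ≤ k` and a weight slope `0 ≤ δ < freeα d`, for ANY two-sided inverse `Gs` of
`stencilE + Ms` with weighted rows `≤ g` and `W = n⁻²·1 − Ms` with weighted rows `≤ w` (`g, w ≥ 0`), the weighted rows of
`rowDiff ν Gs`, `rowDiff μ (rowDiff ν Gs)`, `Gs·colDiff ν`, `Gs·colDiff μ·colDiff ν` are at most `(1 + w·g)` times the free bounds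
(F1ᶜ) ∕ (F2ᶜ) of part (i) §2. [folklore] -/
theorem step_weighted {j : ℕ} (hj : j ≤ k) {δ : ℝ} (hδ : 0 ≤ δ) (hδa : δ < freeα d) (μ ν : Fin (d + 1))
    (Ms Gs : Matrix (TPt (d + 1) (N * L ^ k) × Fin (d + 1)) (TPt (d + 1) (N * L ^ k) × Fin (d + 1)) ℝ)
    (hKG : (stencilE d k N L + Ms) * Gs = 1) (hGK : Gs * (stencilE d k N L + Ms) = 1) {g w : ℝ} (hg : 0 ≤ g) (hw : 0 ≤ w)
    (hG : ∀ x, ∑ z, |Gs x z| * wE d k N L j δ x z ≤ g)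
    (hW : ∀ x, ∑ z, |((((side k L j : ℝ) ^ 2)⁻¹) • (1 : Matrix (TPt (d + 1) (N * L ^ k) × Fin (d + 1)) (TPt (d + 1) (N * L ^ k) × Fin (d + 1)) ℝ) - Ms) x z| * wE d k N L j δ x z ≤ w)
    (p : TPt (d + 1) (N * L ^ k) × Fin (d + 1)) :
    (∑ z, |rowDiff d k N L ν Gs p z| * wE d k N L j δ p z
        ≤ Real.exp δ * (freeC d * (L : ℝ) ^ j * Real.exp (δ * (d + 1)) * ((2 : ℝ) ^ (d + 1) * countConst (freeα d - δ) (d + 1)))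
          * (1 + w * g)) ∧
    (∑ z, |rowDiff d k N L μ (rowDiff d k N L ν Gs) p z| * wE d k N L j δ p z
        ≤ Real.exp (2 * δ) * (106000 * 48 ^ d * (1 + Real.log ((L : ℝ) ^ j)) * Real.exp (δ * (d + 1)) *
          ((2 : ℝ) ^ (d + 1) * countConst (freeα d - δ) (d + 1))) * (1 + w * g)) ∧
    (∑ z, |(Gs * colDiff d k N L ν) p z| * wE d k N L j δ p z
        ≤ Real.exp δ * (freeC d * (L : ℝ) ^ j * Real.exp (δ * (d + 1)) * ((2 : ℝ) ^ (d + 1) * countConst (freeα d - δ) (d + 1)))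
          * (1 + w * g)) ∧
    (∑ z, |(Gs * colDiff d k N L μ * colDiff d k N L ν) p z| * wE d k N L j δ p z
        ≤ Real.exp (2 * δ) * (106000 * 48 ^ d * (1 + Real.log ((L : ℝ) ^ j)) * Real.exp (δ * (d + 1)) *
          ((2 : ℝ) ^ (d + 1) * countConst (freeα d - δ) (d + 1))) * (1 + w * g)) := by
  obtain ⟨hEpos, hEtri, -⟩ := wE_facts d k N L j hδ
  obtain ⟨hid1, hid2⟩ := resolvent_identities d k N L j Ms Gs hKG hGK
  have hL1 : (1 : ℝ) ≤ (L : ℝ) ^ j := one_le_pow₀ (by exact_mod_cast Nat.pos_of_ne_zero (NeZero.ne L))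
  have hlog : 0 ≤ Real.log ((L : ℝ) ^ j) := Real.log_nonneg hL1
  have hcF := countConst_pos (sub_pos.2 hδa) (d + 1)
  have he1 : 1 ≤ Real.exp δ := Real.one_le_exp hδ
  -- products `W·Gs` and `Gs·W`
  have hWG : ∀ x, ∑ z, |(((((side k L j : ℝ) ^ 2)⁻¹) • (1 : Matrix (TPt (d + 1) (N * L ^ k) × Fin (d + 1)) (TPt (d + 1) (N * L ^ k) × Fin (d + 1)) ℝ) - Ms) * Gs) x z| * wE d k N L j δ x z ≤ w * g :=
    weightedRow_mul_le _ _ _ hg (fun x z => (hEpos x z).le) hEtri hW hG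
  have hGW : ∀ x, ∑ z, |(Gs * ((((side k L j : ℝ) ^ 2)⁻¹) • (1 : Matrix (TPt (d + 1) (N * L ^ k) × Fin (d + 1)) (TPt (d + 1) (N * L ^ k) × Fin (d + 1)) ℝ) - Ms)) x z| * wE d k N L j δ x z ≤ g * w :=
    weightedRow_mul_le _ _ _ hw (fun x z => (hEpos x z).le) hEtri hG hW
  have hwg : 0 ≤ w * g := mul_nonneg hw hg
  -- the free pieces (F1 upgraded by `e^{δ} ≥ 1` so that row and operator forms share one constant)
  have hF1 : ∀ x, ∑ z, |rowDiff d k N L ν (freeOp d k N L j) x z| * wE d k N L j δ x z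
      ≤ Real.exp δ * (freeC d * (L : ℝ) ^ j * Real.exp (δ * (d + 1)) * ((2 : ℝ) ^ (d + 1) * countConst (freeα d - δ) (d + 1))) := by
    intro x
    have h := weightedRow_rowDiff_freeOp d k N L hj ν hδ hδa x
    have h0 : 0 ≤ freeC d * (L : ℝ) ^ j * Real.exp (δ * (d + 1)) * ((2 : ℝ) ^ (d + 1) * countConst (freeα d - δ) (d + 1)) := by
      unfold freeC; positivity
    calc _ ≤ _ := h
      _ = 1 * _ := (one_mul _).symm
      _ ≤ _ := mul_le_mul_of_nonneg_right he1 h0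
  have hF2 : ∀ x, ∑ z, |rowDiff d k N L μ (rowDiff d k N L ν (freeOp d k N L j)) x z| * wE d k N L j δ x z
      ≤ Real.exp (2 * δ) * (106000 * 48 ^ d * (1 + Real.log ((L : ℝ) ^ j)) * Real.exp (δ * (d + 1)) *
          ((2 : ℝ) ^ (d + 1) * countConst (freeα d - δ) (d + 1))) := by
    intro x
    have h := SliceFlatHessian.weightedRow_rowDiff_rowDiff_freeOp d k N L hj μ ν hδ hδa x
    have he2 : 1 ≤ Real.exp (2 * δ) := Real.one_le_exp (by positivity)
    have h0 : 0 ≤ 106000 * 48 ^ d * (1 + Real.log ((L : ℝ) ^ j)) * Real.exp (δ * (d + 1)) *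
        ((2 : ℝ) ^ (d + 1) * countConst (freeα d - δ) (d + 1)) := by positivity
    calc _ ≤ _ := h
      _ = 1 * _ := (one_mul _).symm
      _ ≤ _ := mul_le_mul_of_nonneg_right he2 h0
  have hF1c := fun x => weightedRow_freeOp_colDiff d k N L hj ν hδ hδa x
  have hF2c := fun x => weightedRow_freeOp_colDiff2 d k N L hj μ ν hδ hδa x
  refine ⟨?_, ?_, ?_, ?_⟩
  · have hX : rowDiff d k N L ν Gs = rowDiff d k N L ν (freeOp d k N L j)
        + rowDiff d k N L ν (freeOp d k N L j) * (((((side k L j : ℝ) ^ 2)⁻¹) • (1 : Matrix (TPt (d + 1) (N * L ^ k) × Fin (d + 1)) (TPt (d + 1) (N * L ^ k) × Fin (d + 1)) ℝ) - Ms) * Gs) := by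
      conv_lhs => rw [hid1]
      rw [rowDiff_add, rowDiff_mul]
    rw [hX]
    exact weightedRow_add_mul_right_le _ _ _ hwg (fun x z => (hEpos x z).le) hEtri hF1 hWG p
  · have hX : rowDiff d k N L μ (rowDiff d k N L ν Gs) = rowDiff d k N L μ (rowDiff d k N L ν (freeOp d k N L j))
        + rowDiff d k N L μ (rowDiff d k N L ν (freeOp d k N L j)) * (((((side k L j : ℝ) ^ 2)⁻¹) • (1 : Matrix (TPt (d + 1) (N * L ^ k) × Fin (d + 1)) (TPt (d + 1) (N * L ^ k) × Fin (d + 1)) ℝ) - Ms) * Gs) := by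
      conv_lhs => rw [hid1]
      rw [rowDiff_add, rowDiff_add, rowDiff_mul, rowDiff_mul]
    rw [hX]
    exact weightedRow_add_mul_right_le _ _ _ hwg (fun x z => (hEpos x z).le) hEtri hF2 hWG p
  · have hX : Gs * colDiff d k N L ν = freeOp d k N L j * colDiff d k N L ν
        + Gs * ((((side k L j : ℝ) ^ 2)⁻¹) • (1 : Matrix (TPt (d + 1) (N * L ^ k) × Fin (d + 1)) (TPt (d + 1) (N * L ^ k) × Fin (d + 1)) ℝ) - Ms) * (freeOp d k N L j * colDiff d k N L ν) := by
      conv_lhs => rw [hid2]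
      simp only [Matrix.add_mul, Matrix.mul_assoc]
    rw [hX, mul_comm w g]
    have ha : 0 ≤ Real.exp δ * (freeC d * (L : ℝ) ^ j * Real.exp (δ * (d + 1)) * ((2 : ℝ) ^ (d + 1) * countConst (freeα d - δ) (d + 1))) :=
      le_trans (Finset.sum_nonneg fun z _ => mul_nonneg (abs_nonneg _) (hEpos p z).le) (hF1c p)
    exact weightedRow_add_mul_left_le _ _ _ ha (fun x z => (hEpos x z).le) hEtri hF1c hGW p
  · have hX : Gs * colDiff d k N L μ * colDiff d k N L ν = freeOp d k N L j * colDiff d k N L μ * colDiff d k N L ν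
        + Gs * ((((side k L j : ℝ) ^ 2)⁻¹) • (1 : Matrix (TPt (d + 1) (N * L ^ k) × Fin (d + 1)) (TPt (d + 1) (N * L ^ k) × Fin (d + 1)) ℝ) - Ms) * (freeOp d k N L j * colDiff d k N L μ * colDiff d k N L ν) := by
      conv_lhs => rw [hid2]
      simp only [Matrix.add_mul, Matrix.mul_assoc]
    rw [hX, mul_comm w g]
    have ha : 0 ≤ Real.exp (2 * δ) * (106000 * 48 ^ d * (1 + Real.log ((L : ℝ) ^ j)) * Real.exp (δ * (d + 1)) *
        ((2 : ℝ) ^ (d + 1) * countConst (freeα d - δ) (d + 1))) :=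
      le_trans (Finset.sum_nonneg fun z _ => mul_nonneg (abs_nonneg _) (hEpos p z).le) (hF2c p)
    exact weightedRow_add_mul_left_le _ _ _ ha (fun x z => (hEpos x z).le) hEtri hF2c hGW p

/-- Weighted rows of `W = n⁻²·1 − Ms` from block-local cube rows of `Ms` (`j ≤ k`, `0 ≤ δ < δ_M`):
`≤ (1 + C_M·e^{δ(d+1)}2^{d+1}countConst(δ_M − δ, d+1))·(L^j)⁻²`. [folklore] -/
theorem weightedRow_W_le {j : ℕ} (hj : j ≤ k) {δ δM CM : ℝ} (hδ : 0 ≤ δ) (hδM : δ < δM) (hCM : 0 ≤ CM)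
    (Ms : Matrix (TPt (d + 1) (N * L ^ k) × Fin (d + 1)) (TPt (d + 1) (N * L ^ k) × Fin (d + 1)) ℝ)
    (hMs : ∀ (x : TPt (d + 1) (N * L ^ k) × Fin (d + 1)) (b : TPt (d + 1) (levM k N L j)),
      ∑ z ∈ Finset.univ.filter (fun z => cubeI (d + 1) k N L (Fin (d + 1)) j z = b), |Ms x z|
        ≤ CM * (((L : ℝ) ^ j) ^ 2)⁻¹ * Real.exp (-(δM * nbd (d + 1) k N L j (cubeI (d + 1) k N L (Fin (d + 1)) j x) b)))
    (x : TPt (d + 1) (N * L ^ k) × Fin (d + 1)) :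
    ∑ z, |((((side k L j : ℝ) ^ 2)⁻¹) • (1 : Matrix (TPt (d + 1) (N * L ^ k) × Fin (d + 1)) (TPt (d + 1) (N * L ^ k) × Fin (d + 1)) ℝ) - Ms) x z| * wE d k N L j δ x z
      ≤ (1 + CM * Real.exp (δ * (d + 1)) * ((2 : ℝ) ^ (d + 1) * countConst (δM - δ) (d + 1))) * (((L : ℝ) ^ j) ^ 2)⁻¹ := by
  classical
  obtain ⟨hEpos, -, hEdiag⟩ := wE_facts d k N L j hδ
  have hside : (side k L j : ℝ) = (L : ℝ) ^ j := by rw [SliceFlatMassTerm.side_eq_pow k L hj]; push_cast; rfl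
  have hL : (0 : ℝ) < (L : ℝ) := by exact_mod_cast Nat.pos_of_ne_zero (NeZero.ne L)
  have hLj : (0 : ℝ) < (L : ℝ) ^ j := pow_pos hL j
  set I1 : Matrix (TPt (d + 1) (N * L ^ k) × Fin (d + 1)) (TPt (d + 1) (N * L ^ k) × Fin (d + 1)) ℝ :=
    (((side k L j : ℝ) ^ 2)⁻¹) • (1 : Matrix (TPt (d + 1) (N * L ^ k) × Fin (d + 1)) (TPt (d + 1) (N * L ^ k) × Fin (d + 1)) ℝ) with hI1
  have h1 : ∑ z, |I1 x z| * wE d k N L j δ x z = (((L : ℝ) ^ j) ^ 2)⁻¹ := by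
    rw [Finset.sum_eq_single x (fun z _ hz => by simp [hI1, Ne.symm hz]) (fun h => absurd (Finset.mem_univ x) h)]
    simp [hI1, hEdiag x, hside, abs_of_pos (inv_pos.2 (pow_pos hLj 2))]
  have hM : ∑ z, |Ms x z| * wE d k N L j δ x z
      ≤ CM * (((L : ℝ) ^ j) ^ 2)⁻¹ * Real.exp (δ * (d + 1)) * ((2 : ℝ) ^ (d + 1) * countConst (δM - δ) (d + 1)) :=
    weightedRow_of_cubeRows d k N L hj Ms hδ hδM (by positivity) x (fun b => hMs x b)
  calc ∑ z, |(I1 - Ms) x z| * wE d k N L j δ x z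
      ≤ ∑ z, (|I1 x z| * wE d k N L j δ x z + |Ms x z| * wE d k N L j δ x z) := by
        refine Finset.sum_le_sum fun z _ => ?_
        rw [Matrix.sub_apply, ← add_mul]
        exact mul_le_mul_of_nonneg_right (abs_sub _ _) (hEpos x z).le
    _ ≤ (((L : ℝ) ^ j) ^ 2)⁻¹ + CM * (((L : ℝ) ^ j) ^ 2)⁻¹ * Real.exp (δ * (d + 1)) * ((2 : ℝ) ^ (d + 1) * countConst (δM - δ) (d + 1)) := by
        rw [Finset.sum_add_distrib, h1]; exact add_le_add le_rfl hM
    _ = _ := by ring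

/-- **THE ABSTRACT FLAT RESOLVENT STEP.**  For all constants `C_M, δ_M, C_G, δ_G` (`δ_M, δ_G > 0`, `C_M, C_G ≥ 0`) there are `B, δ > 0`
(functions of `d` and these four numbers only) such that for all `k, N, L`, every level `j ≤ k` (`n = L^j`) and ALL matrices `Ms, Gs`
on the NE3 carrier with `(stencilE + Ms)·Gs = 1 = Gs·(stencilE + Ms)`, block-local mass rows `Σ_{z∈Δ_j(b)} |Ms(x,z)| ≤ C_M·(L^j)⁻²·e^{−δ_M·nbd}`
and the ZEROTH-ORDER INPUT `Σ_{z∈Δ_j(b)} |Gs(x,z)| ≤ C_G·(L^j)²·e^{−δ_G·nbd}`, the four cube row sums obey, for all `μ ν p y₁`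
(`nbd = nbd_j(Δ_j(p), y₁)`): `Σ_{q∈Δ_j(y₁)} |rowDiff ν Gs p q| ≤ B·L^j·e^{−δ·nbd}`, `Σ |rowDiff μ (rowDiff ν Gs) p q| ≤ B·(1 + log L^j)·e^{−δ·nbd}`,
`Σ |(Gs·colDiff ν) p q| ≤ B·L^j·e^{−δ·nbd}`, `Σ |(Gs·colDiff μ·colDiff ν) p q| ≤ B·(1 + log L^j)·e^{−δ·nbd}`. [folklore] -/
theorem resolventStep_bounds {CM δM CG δG : ℝ} (hCM : 0 ≤ CM) (hδM : 0 < δM) (hCG : 0 ≤ CG) (hδG : 0 < δG) :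
    ∃ B δ : ℝ, 0 < B ∧ 0 < δ ∧ ∀ (k N L : ℕ) [NeZero N] [NeZero L] (j : ℕ), j ≤ k →
      ∀ (Ms Gs : Matrix (TPt (d + 1) (N * L ^ k) × Fin (d + 1)) (TPt (d + 1) (N * L ^ k) × Fin (d + 1)) ℝ),
        (stencilE d k N L + Ms) * Gs = 1 → Gs * (stencilE d k N L + Ms) = 1 →
        (∀ (x : TPt (d + 1) (N * L ^ k) × Fin (d + 1)) (b : TPt (d + 1) (levM k N L j)),
            ∑ z ∈ Finset.univ.filter (fun z => cubeI (d + 1) k N L (Fin (d + 1)) j z = b), |Ms x z|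
              ≤ CM * (((L : ℝ) ^ j) ^ 2)⁻¹ * Real.exp (-(δM * nbd (d + 1) k N L j (cubeI (d + 1) k N L (Fin (d + 1)) j x) b))) →
        (∀ (x : TPt (d + 1) (N * L ^ k) × Fin (d + 1)) (b : TPt (d + 1) (levM k N L j)),
            ∑ z ∈ Finset.univ.filter (fun z => cubeI (d + 1) k N L (Fin (d + 1)) j z = b), |Gs x z|
              ≤ CG * ((L : ℝ) ^ j) ^ 2 * Real.exp (-(δG * nbd (d + 1) k N L j (cubeI (d + 1) k N L (Fin (d + 1)) j x) b))) →
        ∀ (μ ν : Fin (d + 1)) (p : TPt (d + 1) (N * L ^ k) × Fin (d + 1)) (y₁ : TPt (d + 1) (levM k N L j)),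
          (∑ q ∈ Finset.univ.filter (fun q => cubeI (d + 1) k N L (Fin (d + 1)) j q = y₁), |rowDiff d k N L ν Gs p q|
              ≤ B * (L : ℝ) ^ j * Real.exp (-(δ * nbd (d + 1) k N L j (cubeI (d + 1) k N L (Fin (d + 1)) j p) y₁))) ∧
          (∑ q ∈ Finset.univ.filter (fun q => cubeI (d + 1) k N L (Fin (d + 1)) j q = y₁), |rowDiff d k N L μ (rowDiff d k N L ν Gs) p q|
              ≤ B * (1 + Real.log ((L : ℝ) ^ j)) *
                Real.exp (-(δ * nbd (d + 1) k N L j (cubeI (d + 1) k N L (Fin (d + 1)) j p) y₁))) ∧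
          (∑ q ∈ Finset.univ.filter (fun q => cubeI (d + 1) k N L (Fin (d + 1)) j q = y₁), |(Gs * colDiff d k N L ν) p q|
              ≤ B * (L : ℝ) ^ j * Real.exp (-(δ * nbd (d + 1) k N L j (cubeI (d + 1) k N L (Fin (d + 1)) j p) y₁))) ∧
          (∑ q ∈ Finset.univ.filter (fun q => cubeI (d + 1) k N L (Fin (d + 1)) j q = y₁),
              |(Gs * colDiff d k N L μ * colDiff d k N L ν) p q|
              ≤ B * (1 + Real.log ((L : ℝ) ^ j)) *
                Real.exp (-(δ * nbd (d + 1) k N L j (cubeI (d + 1) k N L (Fin (d + 1)) j p) y₁))) := by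
  obtain ⟨hα0, -⟩ := freeα_pos_le d
  set δ : ℝ := min (min (freeα d) δM) δG / 2 with hδdef
  have hmin : 0 < min (min (freeα d) δM) δG := lt_min (lt_min hα0 hδM) hδG
  have hδ : 0 < δ := by rw [hδdef]; linarith
  have hδa : δ < freeα d := by
    have : min (min (freeα d) δM) δG ≤ freeα d := (min_le_left _ _).trans (min_le_left _ _)
    rw [hδdef]; linarith
  have hδm : δ < δM := by
    have : min (min (freeα d) δM) δG ≤ δM := (min_le_left _ _).trans (min_le_right _ _)
    rw [hδdef]; linarith
  have hδg : δ < δG := by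
    have : min (min (freeα d) δM) δG ≤ δG := min_le_right _ _
    rw [hδdef]; linarith
  have hcF := countConst_pos (sub_pos.2 hδa) (d + 1)
  have hcM := countConst_pos (sub_pos.2 hδm) (d + 1)
  have hcG := countConst_pos (sub_pos.2 hδg) (d + 1)
  -- the constants (functions of `d, CM, δM, CG, δG` only)
  set KK : ℝ := Real.exp (δ * (d + 1)) * (2 : ℝ) ^ (d + 1) with hKK
  set CF1 : ℝ := Real.exp δ * (freeC d * KK * countConst (freeα d - δ) (d + 1)) with hCF1
  set CF2 : ℝ := Real.exp (2 * δ) * (106000 * 48 ^ d * KK * countConst (freeα d - δ) (d + 1)) with hCF2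
  set w₀ : ℝ := 1 + CM * KK * countConst (δM - δ) (d + 1) with hw₀
  set g₀ : ℝ := CG * KK * countConst (δG - δ) (d + 1) with hg₀
  have hKK0 : 0 < KK := by rw [hKK]; positivity
  have hCF10 : 0 < CF1 := by rw [hCF1]; unfold freeC; positivity
  have hCF20 : 0 < CF2 := by rw [hCF2]; positivity
  have hw₀0 : 0 ≤ w₀ := by rw [hw₀]; positivity
  have hg₀0 : 0 ≤ g₀ := by rw [hg₀]; positivity
  refine ⟨(CF1 + CF2) * (1 + w₀ * g₀) * Real.exp (δ * (d + 1)), δ, by positivity, hδ,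
    fun k N L _ _ j hj Ms Gs hKG hGK hMs hGs μ ν p y₁ => ?_⟩
  have hL : (0 : ℝ) < (L : ℝ) := by exact_mod_cast Nat.pos_of_ne_zero (NeZero.ne L)
  have hLj : (0 : ℝ) < (L : ℝ) ^ j := pow_pos hL j
  have hL1 : (1 : ℝ) ≤ (L : ℝ) ^ j := one_le_pow₀ (by exact_mod_cast Nat.pos_of_ne_zero (NeZero.ne L))
  have hlog : 0 ≤ Real.log ((L : ℝ) ^ j) := Real.log_nonneg hL1
  -- weighted inputs
  have hG : ∀ x, ∑ z, |Gs x z| * wE d k N L j δ x z ≤ g₀ * ((L : ℝ) ^ j) ^ 2 := fun x =>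
    (weightedRow_of_cubeRows d k N L hj Gs hδ.le hδg (by positivity) x (fun b => hGs x b)).trans
      (le_of_eq (by rw [hg₀, hKK]; ring))
  have hW : ∀ x, ∑ z, |((((side k L j : ℝ) ^ 2)⁻¹) • (1 : Matrix (TPt (d + 1) (N * L ^ k) × Fin (d + 1)) (TPt (d + 1) (N * L ^ k) × Fin (d + 1)) ℝ) - Ms) x z| * wE d k N L j δ x z
      ≤ w₀ * (((L : ℝ) ^ j) ^ 2)⁻¹ := fun x =>
    (weightedRow_W_le d k N L hj hδ.le hδm hCM Ms hMs x).trans (le_of_eq (by rw [hw₀, hKK]; ring))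
  have hwg : (w₀ * (((L : ℝ) ^ j) ^ 2)⁻¹) * (g₀ * ((L : ℝ) ^ j) ^ 2) = w₀ * g₀ := by field_simp
  obtain ⟨h1, h2, h3, h4⟩ := step_weighted d k N L hj hδ.le hδa μ ν Ms Gs hKG hGK (by positivity) (by positivity) hG hW p
  rw [hwg] at h1 h2 h3 h4
  -- the free constants are `CF1·L^j` and `CF2·(1 + log L^j)`
  have e1 : Real.exp δ * (freeC d * (L : ℝ) ^ j * Real.exp (δ * (d + 1)) * ((2 : ℝ) ^ (d + 1) * countConst (freeα d - δ) (d + 1)))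
      = CF1 * (L : ℝ) ^ j := by rw [hCF1, hKK]; ring
  have e2 : Real.exp (2 * δ) * (106000 * 48 ^ d * (1 + Real.log ((L : ℝ) ^ j)) * Real.exp (δ * (d + 1)) *
      ((2 : ℝ) ^ (d + 1) * countConst (freeα d - δ) (d + 1))) = CF2 * (1 + Real.log ((L : ℝ) ^ j)) := by rw [hCF2, hKK]; ring
  rw [e1] at h1 h3
  rw [e2] at h2 h4
  have hE : 0 ≤ Real.exp (-(δ * nbd (d + 1) k N L j (cubeI (d + 1) k N L (Fin (d + 1)) j p) y₁)) := (Real.exp_pos _).le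
  have hX1 : 0 ≤ (1 + w₀ * g₀) * Real.exp (δ * (d + 1)) := by positivity
  have hB1 : CF1 * (L : ℝ) ^ j * (1 + w₀ * g₀) * Real.exp (δ * (d + 1))
      ≤ (CF1 + CF2) * (1 + w₀ * g₀) * Real.exp (δ * (d + 1)) * (L : ℝ) ^ j := by
    have : CF1 * (L : ℝ) ^ j * (1 + w₀ * g₀) * Real.exp (δ * (d + 1)) = CF1 * ((1 + w₀ * g₀) * Real.exp (δ * (d + 1)) * (L : ℝ) ^ j) := by
      ring
    rw [this, show (CF1 + CF2) * (1 + w₀ * g₀) * Real.exp (δ * (d + 1)) * (L : ℝ) ^ j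
      = (CF1 + CF2) * ((1 + w₀ * g₀) * Real.exp (δ * (d + 1)) * (L : ℝ) ^ j) by ring]
    exact mul_le_mul_of_nonneg_right (by linarith) (by positivity)
  have hB2 : CF2 * (1 + Real.log ((L : ℝ) ^ j)) * (1 + w₀ * g₀) * Real.exp (δ * (d + 1))
      ≤ (CF1 + CF2) * (1 + w₀ * g₀) * Real.exp (δ * (d + 1)) * (1 + Real.log ((L : ℝ) ^ j)) := by
    have : CF2 * (1 + Real.log ((L : ℝ) ^ j)) * (1 + w₀ * g₀) * Real.exp (δ * (d + 1))
        = CF2 * ((1 + w₀ * g₀) * Real.exp (δ * (d + 1)) * (1 + Real.log ((L : ℝ) ^ j))) := by ring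
    rw [this, show (CF1 + CF2) * (1 + w₀ * g₀) * Real.exp (δ * (d + 1)) * (1 + Real.log ((L : ℝ) ^ j))
      = (CF1 + CF2) * ((1 + w₀ * g₀) * Real.exp (δ * (d + 1)) * (1 + Real.log ((L : ℝ) ^ j))) by ring]
    exact mul_le_mul_of_nonneg_right (by linarith) (by positivity)
  refine ⟨?_, ?_, ?_, ?_⟩
  · have h := cubeSum_le_of_weightedRow d k N L j (rowDiff d k N L ν Gs) hδ.le p h1 y₁
    exact h.trans (mul_le_mul_of_nonneg_right hB1 hE)
  · have h := cubeSum_le_of_weightedRow d k N L j (rowDiff d k N L μ (rowDiff d k N L ν Gs)) hδ.le p h2 y₁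
    exact h.trans (mul_le_mul_of_nonneg_right hB2 hE)
  · have h := cubeSum_le_of_weightedRow d k N L j (Gs * colDiff d k N L ν) hδ.le p h3 y₁
    exact h.trans (mul_le_mul_of_nonneg_right hB1 hE)
  · have h := cubeSum_le_of_weightedRow d k N L j (Gs * colDiff d k N L μ * colDiff d k N L ν) hδ.le p h4 y₁
    exact h.trans (mul_le_mul_of_nonneg_right hB2 hE)

end Step

/-! ## §2  CHECK: the vector instance `Gs = gFlat j`, `Ms = n⁻²·1 − Wfl j` recovers NE3 part 13 ∕ the second-order flat ENDs -/
section VectorInstance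

/-- `stencilE + (n⁻²·1 − Wfl j) = kFlat j`. [folklore] -/
theorem stencilE_add_eq_kFlat (j : ℕ) :
    stencilE d k N L + ((((side k L j : ℝ) ^ 2)⁻¹) • (1 : Matrix (TPt (d + 1) (N * L ^ k) × Fin (d + 1)) (TPt (d + 1) (N * L ^ k) × Fin (d + 1)) ℝ) - Wfl d k N L j) = kFlat d k N L j := by
  rw [Wfl_eq]; abel

/-- The vector instance of the hypotheses: `kFlat·gFlat = 1 = gFlat·kFlat` in the form the step consumes. [folklore] -/
example (j : ℕ) :
    (stencilE d k N L + ((((side k L j : ℝ) ^ 2)⁻¹) • (1 : Matrix (TPt (d + 1) (N * L ^ k) × Fin (d + 1)) (TPt (d + 1) (N * L ^ k) × Fin (d + 1)) ℝ) - Wfl d k N L j)) * gFlat d k N L j = 1 ∧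
      gFlat d k N L j * (stencilE d k N L + ((((side k L j : ℝ) ^ 2)⁻¹) • (1 : Matrix (TPt (d + 1) (N * L ^ k) × Fin (d + 1)) (TPt (d + 1) (N * L ^ k) × Fin (d + 1)) ℝ) - Wfl d k N L j)) = 1 := by
  rw [stencilE_add_eq_kFlat]
  exact ⟨kFlat_mul_gFlat d k N L j, gFlat_mul_kFlat d k N L j⟩

end VectorInstance

end Summit.QuantumFields.BalabanUV.Beta.GAN24.FlatResolventStep
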